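import Mathlib.LinearAlgebra.Eigenspace.Zero
import Literature.NumberTheory.Automorphic.TateLocalFactors
import Literature.NumberTheory.GaloisRepresentations.LocalClassFieldTheory
import Literature.NumberTheory.GaloisRepresentations.LocalGaloisGroupFrobeniusProofs
import Literature.NumberTheory.GaloisRepresentations.WeilDeligneRepProofs
import Literature.NumberTheory.GaloisRepresentations.WeilGroupFrobeniusPowers
import HarnessLib

/-!
# Uniqueness of the Steinberg-type normal form of a two-dimensional Weil–Deligne representation
(line `Sketch_18745_r1_k1`, crux `DyadicOddResidue.SectorComplement`, stmt-Langlands-18745; lead's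
stub `stub_isEquivalent_of_N_ne_zero` of the rank-2 attack on generic rigidity)

Let `σ = (ρ, N)` be a Frobenius-semisimple Weil–Deligne representation of `W_F` on a
two-dimensional complex space with `N ≠ 0`, and let `v ≠ 0` be a vector of `ker N` on which
`W_F` acts through a quasi-character `α ∘ artin`.  Then `ker N = ℂ v`, and there is a
"Steinberg frame" `(u, v)`: a basis with `N u = v` on which `W_F` acts diagonally,
`ρ(w) u = q^{-deg w} α(artin w) u`, `ρ(w) v = α(artin w) v` (`exists_steinbergFrame`; the
Weil–Deligne relation `ρ(w) N = q^{deg w} N ρ(w)` forces the character of `u`, Frobenius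
semisimplicity of `ρ(i)`, `i ∈ I_F`, kills the possible off-diagonal inertia term).  Consequently two
such representations with the SAME `α` are isomorphic (`stub_isEquivalent_of_N_ne_zero`): the
isomorphism class of a two-dimensional special representation is determined by the character of
its monodromy kernel.

References: P. Deligne, *Les constantes des équations fonctionnelles des fonctions L*, Antwerp II,
LNM 349 (1973), §8.4; J. Tate, *Number theoretic background*, Corvallis 1979, (4.1.4)–(4.1.5)
(the special representation `sp(2)`).
-/

noncomputable section

set_option linter.dupNamespace false

open Module Polynomial
open Literature.NumberTheory.Automorphic Literature.NumberTheory.GaloisRepresentations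
open Literature.NumberTheory.GaloisRepresentations.IsNonarchimedeanLocalField
open Literature.NumberTheory.GaloisRepresentations.WeilGroup

namespace Summit.Langlands.Langlands.Theorems.ReciprocityRigidity

variable {F : Type} [Field F] [ValuativeRel F] [TopologicalSpace F] [IsNonarchimedeanLocalField F]

section Frame

variable {V : Type*} [AddCommGroup V] [Module ℂ V] [FiniteDimensional ℂ V]

/-- A nilpotent endomorphism of a two-dimensional space has square zero (Cayley–Hamilton:
its characteristic polynomial is `X ^ 2`). [folklore] -/
theorem mul_self_eq_zero_of_isNilpotent_of_finrank_eq_two (hV : finrank ℂ V = 2)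
    {N : V →ₗ[ℂ] V} (hN : IsNilpotent N) : N * N = 0 := by
  have hchar : N.charpoly = X ^ 2 := by
    rw [(LinearMap.isNilpotent_iff_charpoly N).1 hN, hV]
  have h := LinearMap.aeval_self_charpoly N
  rw [hchar, map_pow, aeval_X, pow_two] at h
  exact h

/-- In a two-dimensional Weil–Deligne representation with `N ≠ 0`, a non-zero vector of `ker N`
spans `ker N`. [folklore] -/
theorem exists_smul_eq_of_N_apply_eq_zero (hV : finrank ℂ V = 2) (σ : WeilDeligneRep F ℂ V)
    (hN : σ.N ≠ 0) {v : V} (hv : v ≠ 0) (hNv : σ.N v = 0) {x : V} (hx : σ.N x = 0) :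
    ∃ c : ℂ, x = c • v := by
  have hsq := mul_self_eq_zero_of_isNilpotent_of_finrank_eq_two hV σ.isNilpotent_N
  -- `range N ≤ ker N`, `range N ≠ ⊥`, rank–nullity
  have hle : LinearMap.range σ.N ≤ LinearMap.ker σ.N := by
    rintro _ ⟨y, rfl⟩
    exact LinearMap.congr_fun hsq y
  have hrange : 1 ≤ finrank ℂ (LinearMap.range σ.N) := by
    rw [Nat.one_le_iff_ne_zero, Ne, Submodule.finrank_eq_zero, LinearMap.range_eq_bot]
    exact hN
  have hsum := LinearMap.finrank_range_add_finrank_ker σ.N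
  rw [hV] at hsum
  have hmono := Submodule.finrank_mono hle
  have hker : finrank ℂ (LinearMap.ker σ.N) = 1 := by omega
  have hv' : (⟨v, hNv⟩ : LinearMap.ker σ.N) ≠ 0 := fun h => hv (congrArg Subtype.val h)
  obtain ⟨c, hc⟩ := (finrank_eq_one_iff_of_nonzero' _ hv').1 hker ⟨x, hx⟩
  exact ⟨c, (congrArg Subtype.val hc).symm⟩

omit [FiniteDimensional ℂ V] in
/-- Two vectors `x, y` with `N x = y ≠ 0`, `N y = 0` are linearly independent. [folklore] -/
theorem linearIndependent_pair_of_N (σ : WeilDeligneRep F ℂ V) {x y : V} (hx : σ.N x = y)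
    (hy : σ.N y = 0) (hy0 : y ≠ 0) : LinearIndependent ℂ ![x, y] := by
  rw [LinearIndependent.pair_iff]
  intro c₁ c₂ h
  have h1 : c₁ = 0 := by
    have := congrArg σ.N h
    rw [map_add, map_smul, map_smul, hx, hy, smul_zero, add_zero, map_zero] at this
    exact (smul_eq_zero.1 this).resolve_right hy0
  refine ⟨h1, ?_⟩
  rw [h1, zero_smul, zero_add] at h
  exact (smul_eq_zero.1 h).resolve_right hy0

/-- The scalar `b(w) = q^{-deg w} · α(artin w)` through which `W_F` acts on the complement of the
monodromy kernel of a Steinberg-type representation is multiplicative. [folklore] -/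
theorem steinbergScalar_mul (d : LocalArtinData F) (α : QuasiChar F) (w w' : WeilGroup F) :
    ((residueFieldCard F : ℂ) ^ (-deg (w * w')) * ((α (d.artin (w * w')) : ℂˣ) : ℂ)) =
      ((residueFieldCard F : ℂ) ^ (-deg w) * ((α (d.artin w) : ℂˣ) : ℂ)) *
        ((residueFieldCard F : ℂ) ^ (-deg w') * ((α (d.artin w') : ℂˣ) : ℂ)) := by
  rw [deg_mul IsFrobPow.mul_holds IsFrobPow.unique_holds, map_mul, map_mul, Units.val_mul,
    neg_add, zpow_add₀ (by exact_mod_cast residueFieldCard_ne_zero F)]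
  ring

/-- … and inverts. [folklore] -/
theorem steinbergScalar_inv (d : LocalArtinData F) (α : QuasiChar F) (w : WeilGroup F) :
    ((residueFieldCard F : ℂ) ^ (-deg w⁻¹) * ((α (d.artin w⁻¹) : ℂˣ) : ℂ)) =
      ((residueFieldCard F : ℂ) ^ (-deg w) * ((α (d.artin w) : ℂˣ) : ℂ))⁻¹ := by
  rw [deg_inv IsFrobPow.mul_holds IsFrobPow.unique_holds, neg_neg, map_inv, map_inv,
    Units.val_inv_eq_inv_val, mul_inv, zpow_neg, inv_inv]

/-- **The Steinberg frame.**  Let `σ` be a Frobenius-semisimple Weil–Deligne representation on a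
two-dimensional space with `N ≠ 0`, and `v ≠ 0` a vector of `ker N` on which `W_F` acts by
`α ∘ artin`.  Then there is `u` with `N u = v` on which `W_F` acts by the character
`w ↦ q^{-deg w} α(artin w)`.  (A geometric Frobenius `Φ` acts on `V / ker N ≅ im N = ker N` by
`q · α(artin Φ) ≠ α(artin Φ)`, whence a `Φ`-eigenvector `u ∉ ker N`; for `i ∈ I_F`,
`ρ(i) - α(artin i)` is nilpotent and semisimple, hence `0`; and `W_F = ⟨Φ, I_F⟩`.)
[cite: TateCorvallis1979, (4.1.4)–(4.1.5)] -/
theorem exists_steinbergFrame (hV : finrank ℂ V = 2) (d : LocalArtinData F)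
    (σ : WeilDeligneRep F ℂ V) (hss : σ.IsFrobSemisimple) (hN : σ.N ≠ 0) (α : QuasiChar F)
    {v : V} (hv : v ≠ 0) (hNv : σ.N v = 0)
    (hαv : ∀ w : WeilGroup F, σ.ρ w v = ((α (d.artin w) : ℂˣ) : ℂ) • v) :
    ∃ u : V, σ.N u = v ∧ ∀ w : WeilGroup F,
      σ.ρ w u = ((residueFieldCard F : ℂ) ^ (-deg w) * ((α (d.artin w) : ℂˣ) : ℂ)) • u := by
  -- notation: `q`, `a w := α (artin w)`
  set q : ℂ := (residueFieldCard F : ℂ) with hq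
  have hq0 : q ≠ 0 := by rw [hq]; exact_mod_cast residueFieldCard_ne_zero F
  have hq1 : q ≠ 1 := by rw [hq]; exact_mod_cast (one_lt_residueFieldCard F).ne'
  set a : WeilGroup F → ℂ := fun w => ((α (d.artin w) : ℂˣ) : ℂ) with ha
  have ha0 : ∀ w, a w ≠ 0 := fun w => Units.ne_zero _
  have hαv' : ∀ w : WeilGroup F, σ.ρ w v = a w • v := hαv
  -- `N (ρ w x) = q^{-deg w} • ρ w (N x)`
  have hNρ : ∀ (w : WeilGroup F) (x : V), σ.N (σ.ρ w x) = q ^ (-deg w) • σ.ρ w (σ.N x) := by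
    intro w x
    rw [σ.ρ_N_apply w x, smul_smul, ← hq, ← zpow_add₀ hq0, neg_add_cancel, zpow_zero, one_smul]
  -- a vector outside `ker N`
  obtain ⟨x, hx⟩ : ∃ x : V, σ.N x ≠ 0 := by
    by_contra h
    exact hN (LinearMap.ext fun y => not_not.1 (not_exists.1 h y))
  obtain ⟨c, hc⟩ : ∃ c : ℂ, σ.N x = c • v :=
    exists_smul_eq_of_N_apply_eq_zero hV σ hN hv hNv (LinearMap.congr_fun
      (mul_self_eq_zero_of_isNilpotent_of_finrank_eq_two hV σ.isNilpotent_N) x)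
  have hc0 : c ≠ 0 := by
    rintro rfl
    exact hx (by rw [hc, zero_smul])
  -- a geometric Frobenius
  set Φ : WeilGroup F := WeilDeligneRep.geomFrob F (exists_isFrobPow_holds F) with hΦ
  have hdegΦ : deg Φ = -1 := WeilDeligneRep.deg_geomFrob' _
  -- `ρ Φ x - (q a Φ) • x ∈ ker N`
  have hkey : σ.N (σ.ρ Φ x - (q * a Φ) • x) = 0 := by
    rw [map_sub, map_smul, hNρ, hc, map_smul, hαv', hdegΦ, neg_neg, zpow_one]
    module
  obtain ⟨t, ht⟩ := exists_smul_eq_of_N_apply_eq_zero hV σ hN hv hNv hkey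
  -- the Frobenius eigenvector `u₀ := x + s • v`, `s := t / (a Φ * (q - 1))`
  set s : ℂ := t / (a Φ * (q - 1)) with hs
  have hsrel : t + s * a Φ = q * a Φ * s := by
    have h1 : a Φ * (q - 1) ≠ 0 := mul_ne_zero (ha0 Φ) (sub_ne_zero.2 hq1)
    have h2 : s * (a Φ * (q - 1)) = t := div_mul_cancel₀ t h1
    linear_combination (-1 : ℂ) * h2
  set u₀ : V := x + s • v with hu₀
  have hNu₀ : σ.N u₀ = c • v := by rw [hu₀, map_add, map_smul, hNv, smul_zero, add_zero, hc]
  have hΦu₀ : σ.ρ Φ u₀ = (q * a Φ) • u₀ := by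
    have h1 : σ.ρ Φ x = (q * a Φ) • x + t • v := by rw [← ht, add_sub_cancel]
    rw [hu₀, map_add, map_smul, h1, hαv', smul_add, smul_smul, smul_smul, add_assoc, ← add_smul,
      hsrel]
  -- normalise: `u := c⁻¹ • u₀`, so that `N u = v`
  obtain ⟨u, hNu, hΦu⟩ : ∃ u : V, σ.N u = v ∧ σ.ρ Φ u = (q * a Φ) • u :=
    ⟨c⁻¹ • u₀, by rw [map_smul, hNu₀, smul_smul, inv_mul_cancel₀ hc0, one_smul],
      by rw [map_smul, hΦu₀, smul_comm]⟩
  -- `(u, v)` is a basis of `V`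
  have hcard : Fintype.card (Fin 2) = finrank ℂ V := by rw [Fintype.card_fin, hV]
  set b : Basis (Fin 2) ℂ V :=
    basisOfLinearIndependentOfCardEqFinrank (linearIndependent_pair_of_N σ hNu hNv hv) hcard
    with hb
  have hb0 : b 0 = u := by rw [hb, coe_basisOfLinearIndependentOfCardEqFinrank]; rfl
  have hb1 : b 1 = v := by rw [hb, coe_basisOfLinearIndependentOfCardEqFinrank]; rfl
  -- inertia acts on `u` by `a i`
  have hIu : ∀ i ∈ inertia F, σ.ρ i u = a i • u := by
    intro i hi
    have hdeg : deg i = 0 :=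
      (deg_eq_zero_iff_mem_inertia IsFrobPow.mul_holds IsFrobPow.unique_holds).2 hi
    -- `ρ i u - a i • u ∈ ker N`
    have h1 : σ.N (σ.ρ i u - a i • u) = 0 := by
      rw [map_sub, map_smul, hNρ, hNu, hαv', hdeg, neg_zero, zpow_zero, one_smul, sub_self]
    obtain ⟨t', ht'⟩ := exists_smul_eq_of_N_apply_eq_zero hV σ hN hv hNv h1
    -- `T := ρ i - a i` is nilpotent (`T u = t' v`, `T v = 0`) and semisimple, hence zero
    set T : Module.End ℂ V := σ.ρ i - algebraMap ℂ (Module.End ℂ V) (a i) with hT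
    have hTu : T u = t' • v := by
      rw [hT, LinearMap.sub_apply, Module.algebraMap_end_apply, ht']
    have hTv : T v = 0 := by
      rw [hT, LinearMap.sub_apply, Module.algebraMap_end_apply, hαv', sub_self]
    have hT2 : T * T = 0 := by
      refine b.ext fun j => ?_
      fin_cases j
      · change T (T (b 0)) = 0
        rw [hb0, hTu, map_smul, hTv, smul_zero]
      · change T (T (b 1)) = 0
        rw [hb1, hTv, map_zero]
    have hTnil : IsNilpotent T := ⟨2, by rw [pow_two, hT2]⟩
    have hTss : T.IsSemisimple := Module.End.isSemisimple_sub_algebraMap_iff.2 (hss i)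
    have hT0 : T = 0 := Module.End.eq_zero_of_isNilpotent_isSemisimple hTnil hTss
    have h2 : t' • v = 0 := by rw [← hTu, hT0, LinearMap.zero_apply]
    have ht'0 : t' = 0 := (smul_eq_zero.1 h2).resolve_right hv
    rw [ht'0, zero_smul, sub_eq_zero] at ht'
    exact ht'
  -- `W_F = ⟨Φ, I_F⟩`: the subgroup of `w` acting on `u` by `q^{-deg w} a w` is everything
  let S : Subgroup (WeilGroup F) :=
    { carrier := {w | σ.ρ w u = (q ^ (-deg w) * a w) • u}
      mul_mem' := fun {w w'} hw hw' => by
        simp only [Set.mem_setOf_eq] at hw hw' ⊢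
        rw [map_mul, Module.End.mul_apply, hw', map_smul, hw, smul_smul,
          steinbergScalar_mul d α w w', mul_comm]
      one_mem' := by
        simp only [Set.mem_setOf_eq, map_one, Module.End.one_apply,
          deg_one IsFrobPow.mul_holds IsFrobPow.unique_holds, neg_zero, zpow_zero, ha, map_one,
          Units.val_one, mul_one, one_smul]
      inv_mem' := fun {w} hw => by
        simp only [Set.mem_setOf_eq] at hw ⊢
        have hne : q ^ (-deg w) * a w ≠ 0 := mul_ne_zero (zpow_ne_zero _ hq0) (ha0 w)
        have h1 : σ.ρ w⁻¹ (σ.ρ w u) = u := by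
          rw [← Module.End.mul_apply, ← map_mul, inv_mul_cancel, map_one, Module.End.one_apply]
        rw [hw, map_smul] at h1
        have h2 : σ.ρ w⁻¹ u = (q ^ (-deg w) * a w)⁻¹ • u := (eq_inv_smul_iff₀ hne).2 h1
        rw [h2, steinbergScalar_inv d α w] }
  have hΦS : Φ ∈ S := by
    change σ.ρ Φ u = (q ^ (-deg Φ) * a Φ) • u
    rw [hΦu, hdegΦ, neg_neg, zpow_one]
  have hIS : inertia F ≤ S := fun i hi => by
    change σ.ρ i u = (q ^ (-deg i) * a i) • u
    rw [hIu i hi, (deg_eq_zero_iff_mem_inertia IsFrobPow.mul_holds IsFrobPow.unique_holds).2 hi,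
      neg_zero, zpow_zero, one_mul]
  have hS : S = ⊤ := subgroup_eq_top_of_inertia_le hdegΦ hΦS hIS
  refine ⟨u, hNu, fun w => ?_⟩
  have hw : w ∈ S := hS ▸ Subgroup.mem_top w
  exact hw

end Frame

/-- **Stub NF-St-unique (lead): two Frobenius-semisimple two-dimensional Weil–Deligne
representations with `N ≠ 0` whose monodromy kernels carry the SAME quasi-character `α` are
isomorphic.**  Map the Steinberg frame `(u, v)` of `σ` (`exists_steinbergFrame`) to that of `σ'`:
both frames are bases, `W_F` acts on them through the same pair of characters
`(q^{-deg} · α ∘ artin, α ∘ artin)`, and `N u = v`, `N v = 0` on both sides.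
[cite: TateCorvallis1979, (4.1.4)–(4.1.5)] -/
theorem stub_isEquivalent_of_N_ne_zero
    (d : LocalArtinData F)
    {V : Type*} [AddCommGroup V] [Module ℂ V] [FiniteDimensional ℂ V] (hV : finrank ℂ V = 2)
    {V' : Type*} [AddCommGroup V'] [Module ℂ V'] [FiniteDimensional ℂ V'] (hV' : finrank ℂ V' = 2)
    (σ : WeilDeligneRep F ℂ V) (σ' : WeilDeligneRep F ℂ V')
    (hss : σ.IsFrobSemisimple) (hss' : σ'.IsFrobSemisimple) (hN : σ.N ≠ 0) (hN' : σ'.N ≠ 0)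
    (α : QuasiChar F)
    (v : V) (hv : v ≠ 0) (hNv : σ.N v = 0)
    (hαv : ∀ w : WeilGroup F, σ.ρ w v = ((α (d.artin w) : ℂˣ) : ℂ) • v)
    (v' : V') (hv' : v' ≠ 0) (hNv' : σ'.N v' = 0)
    (hαv' : ∀ w : WeilGroup F, σ'.ρ w v' = ((α (d.artin w) : ℂˣ) : ℂ) • v') :
    σ.IsEquivalent σ' := by
  obtain ⟨u, hNu, hu⟩ := exists_steinbergFrame hV d σ hss hN α hv hNv hαv
  obtain ⟨u', hNu', hu'⟩ := exists_steinbergFrame hV' d σ' hss' hN' α hv' hNv' hαv'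
  -- the two frames are bases
  have hcard : Fintype.card (Fin 2) = finrank ℂ V := by rw [Fintype.card_fin, hV]
  have hcard' : Fintype.card (Fin 2) = finrank ℂ V' := by rw [Fintype.card_fin, hV']
  set b : Basis (Fin 2) ℂ V :=
    basisOfLinearIndependentOfCardEqFinrank (linearIndependent_pair_of_N σ hNu hNv hv) hcard
    with hb
  set b' : Basis (Fin 2) ℂ V' :=
    basisOfLinearIndependentOfCardEqFinrank (linearIndependent_pair_of_N σ' hNu' hNv' hv') hcard'
    with hb'
  have hb0 : b 0 = u := by rw [hb, coe_basisOfLinearIndependentOfCardEqFinrank]; rfl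
  have hb1 : b 1 = v := by rw [hb, coe_basisOfLinearIndependentOfCardEqFinrank]; rfl
  have hb'0 : b' 0 = u' := by rw [hb', coe_basisOfLinearIndependentOfCardEqFinrank]; rfl
  have hb'1 : b' 1 = v' := by rw [hb', coe_basisOfLinearIndependentOfCardEqFinrank]; rfl
  -- the linear isomorphism `b i ↦ b' i`
  set e : V ≃ₗ[ℂ] V' := b.equiv b' (Equiv.refl (Fin 2)) with he
  have he0 : e u = u' := by rw [← hb0, he, Basis.equiv_apply, Equiv.refl_apply, hb'0]
  have he1 : e v = v' := by rw [← hb1, he, Basis.equiv_apply, Equiv.refl_apply, hb'1]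
  -- equivariance
  have hρ : ∀ w : WeilGroup F, (e : V →ₗ[ℂ] V') ∘ₗ σ.ρ w = σ'.ρ w ∘ₗ (e : V →ₗ[ℂ] V') := by
    intro w
    refine b.ext fun j => ?_
    fin_cases j
    · change e (σ.ρ w (b 0)) = σ'.ρ w (e (b 0))
      rw [hb0, hu, map_smul, he0, hu']
    · change e (σ.ρ w (b 1)) = σ'.ρ w (e (b 1))
      rw [hb1, hαv, map_smul, he1, hαv']
  have hNN : (e : V →ₗ[ℂ] V') ∘ₗ σ.N = σ'.N ∘ₗ (e : V →ₗ[ℂ] V') := by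
    refine b.ext fun j => ?_
    fin_cases j
    · change e (σ.N (b 0)) = σ'.N (e (b 0))
      rw [hb0, hNu, he1, he0, hNu']
    · change e (σ.N (b 1)) = σ'.N (e (b 1))
      rw [hb1, hNv, map_zero, he1, hNv']
  exact ⟨{ toRepEquiv := Representation.Equiv.mk e hρ, comm_N := hNN }⟩

end Summit.Langlands.Langlands.Theorems.ReciprocityRigidity

end
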